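import Summits.Ventures.ResidMod.RowVerdictListed
import Summits.Ventures.ResidMod.InstanceKit
import Literature.NumberTheory.DiophantineGeometry.Bcgp2025ModThreeImageOrder2304
import Literature.NumberTheory.DiophantineGeometry.Bcgp2025ModThreeDecompositionImageModular
import HarnessLib

/-!
# Venture ResidMod — census row 7889.b.55223.1, flag T-S (mod-3 image of order 2304 = class 3.45.1):
# REPRODUCTION of BCGP 2025's own printed instance (§10.1, "the curve of conductor 7³·23"), GIVEN
# Thm. 9.5.2, Lemma 6.4.3 (row 3.45.1), Deligne's criterion, Néron–Ogg–Shafarevich, and the certificate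

HONEST FRAMING. A per-surface INSTANCE of `modular_of_mod3ListedRowNOS` — a REPRODUCTION OF A PRINTED
INSTANCE (STEP-0 grade, lead R71(b)), NOT a new modularity claim and NOT an unconditional proof: BCGP 2025
§10.1 prints "there are three additional curves, precisely one of which we can deduce is modular by
Theorem 9.5.2. This is the curve of conductor `7³ · 23`. The representation `ρ̄_{A,3}` in this case (with
image of order `2304`) is induced from a representation `ρ̄_{E,3} : G_F → GL₂(𝔽₃)`, where `E` is a modular
elliptic curve over `F = ℚ(√−7)`". Curve (LMFDB `7889.b.55223.1`, conductor `7889 = 7³·23`):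

  `X : y² + (x³ + x² + 1) y = x³ − 4x − 2`.

Hypotheses (all cited theorems as named facts, NOT proved in the tree): `hList` (Thm. 9.5.2 with Lemma
6.4.3, `bcgp2025_modThreeListedImage_modular_abelianSurface`), `h2304` (Lemma 6.4.3 / Table 6.4.4 row
3.45.1 + [CCG20 Lemma 2]: image ORDER `2304` ⟹ the four image clauses,
`bcgp2025_lemma643_modThreeImage_order2304`, LIT-2), `hDel` (Deligne / Howe), `hNOS` (Serre–Tate Thm. 1).
BINDERS (the cell's certificate; not kernel-checkable): the torsion frame of `ρb`; `J, hJalt, hJdet, hsymp`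
(polarization ⟹ symplectic with multiplier `ε̄⁻¹`); the IMAGE slot — structural form `himg :
ρb.HasDecompositionStabilizerImage J` in `modular_7889b` (import of record, lead R117(b); LIT-1's proved
`bcgp2025_modThreeDecompositionImage_liftingConditions`), or order form `hcard : |im ρ̄_{A,3}| = 2304` in
`modular_7889b_of_card` (LIT-2's `bcgp2025_listedImageClauses_of_modThreeImage_order2304`) — the cell's EXACT
mod-3 image certificate ×2 (e3x2 rational decomposition orbit + P1 `N_dec` lower bound; LMFDB label 3.45.1
×1); `hEnd : End(A_ℚ̄) = ℤ` — an LMFDB endomorphism datum ×1 (`geom_end_alg = Q`), NOT certifiable by the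
cell's L-TYP (mod-3 image not surjective, mod-2 image 2.40.2): this row is CONDITIONAL on it as printed.
Euler factors (P1 leg `census/p1/FLAGS-p1.tsv`, census signature: signed 2026-08-22T07:50:36Z; the seat's
stdlib counter agrees): `L₂ = 1 + T + T² + 2T³ + 4T⁴` (`(a₂,b₂) = (−1,1)`, Frob₂ class 8A: F2OK and
UNRAM2 derived), `L₃ = 1 + T² + 9T⁴` (`(a₃,b₃) = (0,1)`: `3 ∤ 1` ⟹ ordinary; Bézout
`(70 − 36T²)·L₃ + (−17T + 9T³)·L₃' = 70` ⟹ `3`-distinguished; GOOD(3) via `hNOS`).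

References: [BoxerCalegariGeePilloni2025] arXiv:2502.20645 §10.1 (the `7³·23` curve), Thm. 9.5.2, Lemma
6.4.3, Table 6.4.4; [CalegariChidambaramGhitza2020] Lemma 2; [LMFDB] genus-2 curve 7889.b.55223.1.
-/

noncomputable section

namespace Summit.Ventures.ResidMod.Instances

open Equiv CategoryTheory IsDedekindDomain Field Polynomial Matrix
open scoped NumberField
open Literature.NumberTheory.GaloisRepresentations Literature.NumberTheory.Automorphic
open Literature.NumberTheory.Automorphic.Paramodular
open Literature.NumberTheory.DiophantineGeometry Literature.NumberTheory.FaltingsSerre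
open Literature.AlgebraicGeometry.Motives (AbelianVariety HasGoodReductionAt)
open Summit.Ventures.ResidMod

/-- DIST0(3) for 7889.b: `L₃ = 1 + T² + 9T⁴` is separable over `ℚ` (Bézout identity with `N = 70`).
[cite: BoxerCalegariGeePilloni2025, Def. 9.1.2] -/
theorem separable_L3_7889b : ((lPolynomialOfSurface 3 0 1).map (Int.castRingHom ℚ)).Separable := by
  apply separable_of_intBezout (U := 70 - 36 * X ^ 2) (V := -17 * X + 9 * X ^ 3) (N := 70) (by norm_num)
  rw [derivative_map_lPolynomialOfSurface_eq, map_lPolynomialOfSurface_eq]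
  push_cast
  ring

/-- **Census row 7889.b.55223.1, ORDER form of the image certificate**: as `modular_7889b` but with the
image slot entered as the bare ORDER `hcard : |im ρ̄_{A,3}| = 2304` (what an EXACT order certificate
delivers) instead of the structural `HasDecompositionStabilizerImage`. Binders: torsion frame; `J` with
`hJalt/hJdet/hsymp`; `hcard`; `hEnd` (`End(A_ℚ̄) = ℤ`, LMFDB ×1); Euler factors `L₂ = (−1,1)`, `L₃ = (0,1)`.
Kernel: F2OK, `3 ∤ b₃`, Bézout; derived: UNRAM2, GOOD(3), ORD(3), (3b), the image clauses (via `h2304`).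
[cite: BoxerCalegariGeePilloni2025, §10.1, Thm. 9.5.2, Lemma 6.4.3] -/
theorem modular_7889b_of_card (hList : bcgp2025_modThreeListedImage_modular_abelianSurface)
    (h2304 : bcgp2025_lemma643_modThreeImage_order2304)
    (hDel : deligne_hasGoodOrdinaryReductionAt_iff_not_dvd_middleCoeff)
    (A : AbelianVariety ℚ) (hA : A.dim = 2)
    (hNOS : ∀ v : HeightOneSpectrum (𝓞 ℚ), A.hasGoodReductionAt_of_isUnramifiedAt v)
    (ρb : FramedGaloisRep ℚ (ZMod 3) 4)
    (hframe : ∃ e₃ : A.geomTorsion (3 : ℕ) ≃+ (Fin 4 → ZMod 3),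
      ∀ (g : absoluteGaloisGroup ℚ) (P : A.geomTorsion (3 : ℕ)),
        e₃ (g • P) = ((ρb g⁻¹ : GL (Fin 4) (ZMod 3)) : Matrix (Fin 4) (Fin 4) (ZMod 3))ᵀ *ᵥ e₃ P)
    (J : Matrix (Fin 4) (Fin 4) (ZMod 3)) (hJalt : Jᵀ = -J) (hJdet : IsUnit J.det)
    (hsymp : ∀ σ : absoluteGaloisGroup ℚ,
      (ρb σ).valᵀ * J * (ρb σ).val =
        (((modPCyclotomicCharacterZMod ℚ 3 σ)⁻¹ : (ZMod 3)ˣ) : ZMod 3) • J)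
    (hcard : Nat.card (ρb.imageOn ⊤) = 2304)
    (hEnd : ∀ f : A.baseChange (AlgebraicClosure ℚ) ⟶ A.baseChange (AlgebraicClosure ℚ),
      ∃ n : ℤ, f = n • 𝟙 (A.baseChange (AlgebraicClosure ℚ)))
    (hL2 : A.HasGoodEulerFactorAt 2 ((lPolynomialOfSurface 2 (-1) 1).map (Int.castRingHom ℚ)))
    (hL3 : A.HasGoodEulerFactorAt 3 ((lPolynomialOfSurface 3 0 1).map (Int.castRingHom ℚ))) :
    ∀ (p : ℕ) [Fact p.Prime] (b : Module.Basis (Fin 4) ℚ_[p] (A.rationalTateModule p))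
      (r : FramedGaloisRep ℚ (PadicAlgCl p) 4),
      (∀ g : absoluteGaloisGroup ℚ,
        (r g).val =
          ((LinearMap.toMatrix b b (A.rationalTateRep p g⁻¹)).map
            (algebraMap ℚ_[p] (PadicAlgCl p))).transpose) →
      ∀ (hcpt : isCompact_glFiniteIntegralLevel 4 ℚ) (ι : PadicAlgCl p ≃+* ℂ),
        IsAutomorphicAE ι hcpt r := by
  obtain ⟨e₃, he₃⟩ := hframe
  have hframe' : ∀ (σ : absoluteGaloisGroup ℚ) (P : A.geomTorsion (3 : ℕ)),
      e₃ (σ • P) = ((FramedRep.dual ρb σ : GL (Fin 4) (ZMod 3)) :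
        Matrix (Fin 4) (Fin 4) (ZMod 3)) *ᵥ e₃ P := by
    intro σ P
    rw [he₃, FramedRep.coe_dual_apply, map_inv]
  have hgood₃ := hasGoodReductionAt_of_hasGoodEulerFactorAt hA hNOS Nat.prime_three hL3
  obtain ⟨himg, habs, hrs₁, hrs₂⟩ := bcgp2025_listedImageClauses_of_modThreeImage_order2304 h2304 A hA
    (FramedRep.dual ρb) e₃ ρb hframe' (FramedRep.dual_dual ρb) J hJalt hJdet hsymp hgood₃ hcard
  exact modular_of_mod3ListedRowNOS hList hDel A hA hNOS ρb ⟨e₃, he₃⟩ himg habs hrs₁ hrs₂ hEnd hL2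
    (by decide) hL3 (by decide) separable_L3_7889b

/-- **Census row 7889.b.55223.1 (flag T-S, image = the decomposition stabiliser `N_dec`, class 3.45.1):
modular GIVEN Thm. 9.5.2 (`hList`), Lemma 6.4.3 row 3.45.1 (`h2304`), Deligne's criterion (`hDel`),
Néron–Ogg–Shafarevich (`hNOS`), and the certificate** — a REPRODUCTION of BCGP 2025's printed §10.1
instance (STEP-0 grade), import of record per lead R117(b): the image slot is the STRUCTURAL certificate
`himg : ρb.HasDecompositionStabilizerImage J` ("the image is exactly the stabiliser in `GSp(J)(𝔽₃)` of a
non-degenerate plane pair `{P, P^⊥}`" — the cell's EXACT image certificate ×2: e3x2 rational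
decomposition orbit (upper bound) + P1 `N_dec` escape of every maximal subclass (lower bound)), from which
LIT-1's PROVED `bcgp2025_modThreeDecompositionImage_liftingConditions h2304` yields the image clauses (no
order binder, no finite-group binder). Other binders: torsion frame; `J, hJalt, hJdet, hsymp`; `hEnd`
(`End(A_ℚ̄) = ℤ`: LMFDB ×1, NOT L-TYP-certifiable for this image — conditional as printed). Euler factors
`L₂ = (−1,1)` (F2OK, UNRAM2 derived), `L₃ = (0,1)` (`3 ∤ 1` ⟹ ORD(3) via `hDel`; Bézout `N = 70` ⟹
DIST0(3); GOOD(3) via `hNOS`). [cite: BoxerCalegariGeePilloni2025, §10.1 (conductor 7³·23), Thm. 9.5.2, Lemma 6.4.3, Table 6.4.4 row 3.45.1] -/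
theorem modular_7889b (hList : bcgp2025_modThreeListedImage_modular_abelianSurface)
    (h2304 : bcgp2025_lemma643_modThreeImage_order2304)
    (hDel : deligne_hasGoodOrdinaryReductionAt_iff_not_dvd_middleCoeff)
    (A : AbelianVariety ℚ) (hA : A.dim = 2)
    (hNOS : ∀ v : HeightOneSpectrum (𝓞 ℚ), A.hasGoodReductionAt_of_isUnramifiedAt v)
    (ρb : FramedGaloisRep ℚ (ZMod 3) 4)
    (hframe : ∃ e₃ : A.geomTorsion (3 : ℕ) ≃+ (Fin 4 → ZMod 3),
      ∀ (g : absoluteGaloisGroup ℚ) (P : A.geomTorsion (3 : ℕ)),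
        e₃ (g • P) = ((ρb g⁻¹ : GL (Fin 4) (ZMod 3)) : Matrix (Fin 4) (Fin 4) (ZMod 3))ᵀ *ᵥ e₃ P)
    (J : Matrix (Fin 4) (Fin 4) (ZMod 3)) (hJalt : Jᵀ = -J) (hJdet : IsUnit J.det)
    (hsymp : ∀ σ : absoluteGaloisGroup ℚ,
      (ρb σ).valᵀ * J * (ρb σ).val =
        (((modPCyclotomicCharacterZMod ℚ 3 σ)⁻¹ : (ZMod 3)ˣ) : ZMod 3) • J)
    (himg : ρb.HasDecompositionStabilizerImage J)
    (hEnd : ∀ f : A.baseChange (AlgebraicClosure ℚ) ⟶ A.baseChange (AlgebraicClosure ℚ),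
      ∃ n : ℤ, f = n • 𝟙 (A.baseChange (AlgebraicClosure ℚ)))
    (hL2 : A.HasGoodEulerFactorAt 2 ((lPolynomialOfSurface 2 (-1) 1).map (Int.castRingHom ℚ)))
    (hL3 : A.HasGoodEulerFactorAt 3 ((lPolynomialOfSurface 3 0 1).map (Int.castRingHom ℚ))) :
    ∀ (p : ℕ) [Fact p.Prime] (b : Module.Basis (Fin 4) ℚ_[p] (A.rationalTateModule p))
      (r : FramedGaloisRep ℚ (PadicAlgCl p) 4),
      (∀ g : absoluteGaloisGroup ℚ,
        (r g).val =
          ((LinearMap.toMatrix b b (A.rationalTateRep p g⁻¹)).map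
            (algebraMap ℚ_[p] (PadicAlgCl p))).transpose) →
      ∀ (hcpt : isCompact_glFiniteIntegralLevel 4 ℚ) (ι : PadicAlgCl p ≃+* ℂ),
        IsAutomorphicAE ι hcpt r := by
  obtain ⟨e₃, he₃⟩ := hframe
  have hframe' : ∀ (σ : absoluteGaloisGroup ℚ) (P : A.geomTorsion (3 : ℕ)),
      e₃ (σ • P) = ((FramedRep.dual ρb σ : GL (Fin 4) (ZMod 3)) :
        Matrix (Fin 4) (Fin 4) (ZMod 3)) *ᵥ e₃ P := by
    intro σ P
    rw [he₃, FramedRep.coe_dual_apply, map_inv]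
  have hgood₃ := hasGoodReductionAt_of_hasGoodEulerFactorAt hA hNOS Nat.prime_three hL3
  obtain ⟨hreas, htidy, habs, hrs₁, hrs₂⟩ := bcgp2025_modThreeDecompositionImage_liftingConditions h2304
    A hA (FramedRep.dual ρb) e₃ ρb hframe' (FramedRep.dual_dual ρb) hgood₃ J hJalt hJdet hsymp himg
  exact modular_of_mod3ListedRowNOS hList hDel A hA hNOS ρb ⟨e₃, he₃⟩
    ⟨J, hJalt, hJdet, hsymp, hreas, htidy⟩ habs hrs₁ hrs₂ hEnd hL2 (by decide) hL3 (by decide)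
    separable_L3_7889b

end Summit.Ventures.ResidMod.Instances

end
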